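import Literature.NumberTheory.LFunctions.RieszMeanInvDedekindZeta
import HarnessLib

/-!
# Logarithmic Riesz means by Perron's formula, uniformly in a conductor (Landau's contour shift)

Topic `Literature/NumberTheory/LFunctions`, next to `RieszMeanInvDedekindZeta.lean` (Perron's
formula for the kernel `1/s²`, `LogRieszMean.*`, and the contour shift `PerronShift.*` in the
classical region `σ > 1 − c/log(|t|+4)`) and `ClassicalPsiErrorTerm(Explicit).lean` (Landau's
method for `ψ`). Everything in this file is PROVED (theorems only; no definitions, no named facts).

**Purpose.** The prime number theorem for Hecke characters (ray-class characters twisted by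
Grössencharaktere) of a number field `K` — I. Mitsui, *Generalized prime number theorem*, Jap. J.
Math. 26 (1956), 1–42, Lemma 5; used by D. R. Heath-Brown, *Primes represented by `x³ + 2y³`*, Acta
Math. 186 (2001), Lemma 9.4 (p. 55): `∑_{N(P) ≤ z} ν(P) ≪ z exp(−c√(log z))` **uniformly** for
frequencies `|j|, |k| ≤ exp(c√(log z))` and moduli `q ≤ (log z)^A` — rests, on the analytic side, on
the zero-free region `σ > 1 − c/𝓛`, `𝓛 = log Q + log(|t| + 4)` (`Q` = conductor × frequency
parameter), the bound `−L'/L(s, ν) ≪ 𝓛^p` there, and Perron's formula with the contour moved into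
that region. When `log Q` is as large as `√(log z)` the dependence on `Q` cannot be absorbed into the
constant `c` (the form `σ > 1 − (c/(1 + log Q))/log(|t|+4)` of `ClassicalPsiData` loses the whole
saving); one has to keep `λ = log Q` and `log(|t|+4)` on the same footing and choose
`log T ≍ √(log x)`. This file carries out that bookkeeping once, for an abstract Dirichlet series:

Let `λ ≥ 0`, `0 < c ≤ 1/2`, `p ∈ ℕ`, `M, B ≥ 0`, `a : ℕ → ℂ`, `F : ℂ → ℂ` with
* `∑ a(n) n^{-s}` absolutely convergent for `σ > 1`, `∑ |a(n)| n^{-σ} ≤ B/(σ − 1)` for `1 < σ ≤ 2`,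
  and `F(s) = ∑ a(n) n^{-s}` for `σ > 1`;
* `F` holomorphic on `U = {σ > 1 − c/(λ + log(|t| + 4))}` with `|F(s)| ≤ M (λ + log(|t|+4))^p` for
  `s ∈ U`, `σ ≤ 2`.

Then (`PerronConductor.norm_logRieszMean_le_of_le_sqrt`): for `log x ≥ 4` and `λ ≤ √(log x)`,

  `|∑_{n ≤ x} a(n) log(x/n)| ≤ (B + 2·3^p M) (log x)^{p+1} · x · exp(−(c/6)√(log x))`.

(General `T`: `norm_logRieszMean_le`; `T = exp(√log x)` and any `λ ≥ 0`: `norm_logRieszMean_le_sqrt`.)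
The passage from the logarithmic Riesz mean to the sharp cut-off is the elementary differencing
`PerronConductor.norm_sum_le_of_logRieszMean` (`|∑_{n≤x} a(n)| ≤ (|R(y)| + |R(x)|)/log(y/x) +
∑_{x<n≤y} b(n)` for a majorant `b ≥ |a|`), to be used with `y = x·exp(h)`, `h = exp(−c'√log x)` and a
short-interval bound for `∑ b` (e.g. the Weber–Landau ideal count).

## Proof

`R(x) = ∑_{n≤x} a(n) log(x/n) = (1/2πi)∫_{(κ)} F(s) x^s s^{-2} ds`, `κ = 1 + 1/log x`
(`LogRieszMean.sum_mul_log_eq_integral_LSeries`); Cauchy's theorem on `[σ_L, κ] × [−T, T]`,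
`σ_L = 1 − c/(2(λ + log(T+4)))` (`integral_line_eq`); on the left side `|F| ≤ Mℓ^p`,
`ℓ = λ + log(T+4)`, `|x^s| = x^{σ_L}`, `∫dt/|s|² ≤ 2π` (`norm_integral_left_le`); on the horizontal
sides `|F x^s/s²| ≤ Mℓ^p e x/T²` (`norm_integral_horizontal_le`); on `σ = κ`, `|t| > T`, the trivial
bound `|F| ≤ ∑|a(n)|n^{-κ} ≤ B log x` gives `2eBx log x/T` (`norm_integral_Ioi_le`,
`norm_integral_Iic_le`). With `T = exp(√log x)` and `ℓ ≤ λ + √log x + 2 ≤ 3√log x` the three terms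
are `≪ x exp(−(c/6)√log x)`.

## References

* H. L. Montgomery, R. C. Vaughan, *Multiplicative Number Theory I. Classical Theory*, CUP 2007,
  §6.2 (proof of Theorem 6.9) and §11.3 (proof of Theorem 11.16: the same contour with
  `log q + log(|t|+4)`). [cite: MontgomeryVaughan2007, §6.2 and §11.3]
* E. Landau, *Neuer Beweis des Primzahlsatzes und Beweis des Primidealsatzes*, Math. Ann. 56
  (1903), §6. [cite: LandauMathAnn1903, §6]
* I. Mitsui, *Generalized prime number theorem*, Jap. J. Math. 26 (1956), 1–42, Lemma 5 (the
  intended application). [cite: Mitsui1956, Lemma 5]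
* D. R. Heath-Brown, *Primes represented by `x³ + 2y³`*, Acta Math. 186 (2001), 1–84, Lemma 9.4,
  p. 55. [cite: HeathBrownActa2001, Lemma 9.4]

## Mathlib / tree search

Tree: `LogRieszMean.sum_mul_log_eq_integral_LSeries`, `LogRieszMean.integrable_cpow_mul_LSeries_mul_invSq`,
`PerronShift.integral_inv_sq_add_sq`, `PerronShift.integral_line_eq` (the `λ = 0`, shifted-by-one
version; not reusable for `λ > 0` since its region is fixed), `NumberField.norm_LSeries_le_tsum`,
`ClassicalZFRData.one_le_log_tau`, `ClassicalPsiData.norm_add_add_add_sub_le`. Mathlib: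
`Complex.integral_boundary_rect_eq_zero_of_differentiableOn`, `integral_Ioi_rpow_of_lt`,
`intervalIntegral.norm_integral_le_of_norm_le_const`, `Complex.norm_cpow_eq_rpow_re_of_pos`,
`Real.add_pow_le_pow_mul_pow_of_sq_le_sq`, `Real.exp_le_exp`, `Real.sqrt_le_self`-type lemmas.
Searched `lean search 'log Q|conductor.*Perron|lam \+ Real.log \(\|'`: no conductor-uniform
Perron/Landau statement in the tree (`ClassicalPsiErrorTermExplicit` tracks `c, C` but its region is
`σ > 1 − c/log(|t|+4)`).
-/

noncomputable section

open Complex Filter Topology Set MeasureTheory Real intervalIntegral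
open scoped Real Interval

namespace Literature.NumberTheory.LFunctions

namespace PerronConductor

/-- Local notation for the conductor-weighted classical region
`U_{λ,c} = {s : 1 − c/(λ + log(|Im s| + 4)) < Re s}`. -/
local notation3 "U[" lam "," c "]" =>
  {s : ℂ | 1 - c / ((lam : ℝ) + Real.log (|s.im| + 4)) < s.re}

variable {lam c : ℝ}

/-! ### The weight `ℓ_λ(t) = λ + log(|t| + 4)` and the region -/

/-- `ℓ_λ(t) ≥ 1` for `λ ≥ 0`. [folklore] -/
theorem one_le_ell (hlam : 0 ≤ lam) (t : ℝ) : 1 ≤ lam + Real.log (|t| + 4) := by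
  have := ClassicalZFRData.one_le_log_tau t
  linarith

/-- `ℓ_λ(t) > 0` for `λ ≥ 0`. [folklore] -/
theorem ell_pos (hlam : 0 ≤ lam) (t : ℝ) : 0 < lam + Real.log (|t| + 4) := by
  linarith [one_le_ell hlam t]

/-- `ℓ_λ` is monotone in `|t|`: `|t| ≤ T → ℓ_λ(t) ≤ λ + log(T + 4)`. [folklore] -/
theorem ell_le_of_abs_le (lam : ℝ) {t T : ℝ} (h : |t| ≤ T) :
    lam + Real.log (|t| + 4) ≤ lam + Real.log (T + 4) := by
  have : Real.log (|t| + 4) ≤ Real.log (T + 4) := Real.log_le_log (by positivity) (by linarith)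
  linarith

/-- The region `U_{λ,c}` is open. [folklore] -/
theorem isOpen_region (hlam : 0 ≤ lam) (c : ℝ) : IsOpen U[lam, c] := by
  have h1 : Continuous fun s : ℂ ↦ lam + Real.log (|s.im| + 4) :=
    continuous_const.add (((continuous_abs.comp continuous_im).add continuous_const).log
      fun s ↦ (by positivity : (0 : ℝ) < |s.im| + 4).ne')
  have h2 : Continuous fun s : ℂ ↦ 1 - c / (lam + Real.log (|s.im| + 4)) :=
    continuous_const.sub (continuous_const.div h1 fun s ↦ (ell_pos hlam _).ne')
  exact isOpen_lt h2 continuous_re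

/-- The closed half-plane `σ ≥ 1` lies in `U_{λ,c}` (`c > 0`). [folklore] -/
theorem mem_region_of_one_le_re (hlam : 0 ≤ lam) (hc : 0 < c) {s : ℂ} (hs : 1 ≤ s.re) :
    s ∈ U[lam, c] := by
  show 1 - c / (lam + Real.log (|s.im| + 4)) < s.re
  have : 0 < c / (lam + Real.log (|s.im| + 4)) := div_pos hc (ell_pos hlam _)
  linarith

/-- The closed rectangle `Re s ≥ 1 − c/(2(λ + log(T+4)))`, `|Im s| ≤ T` lies in `U_{λ,c}`.
[folklore] -/
theorem mem_region_of_rect (hlam : 0 ≤ lam) (hc : 0 < c) {T : ℝ} {s : ℂ}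
    (hre : 1 - c / (2 * (lam + Real.log (T + 4))) ≤ s.re) (him : |s.im| ≤ T) :
    s ∈ U[lam, c] := by
  show 1 - c / (lam + Real.log (|s.im| + 4)) < s.re
  have hℓ0 : 0 < lam + Real.log (|s.im| + 4) := ell_pos hlam _
  have hℓT : lam + Real.log (|s.im| + 4) ≤ lam + Real.log (T + 4) := ell_le_of_abs_le lam him
  have hℓT0 : 0 < lam + Real.log (T + 4) := hℓ0.trans_le hℓT
  have h1 : c / (2 * (lam + Real.log (T + 4))) < c / (lam + Real.log (T + 4)) := by
    rw [div_lt_div_iff_of_pos_left hc (by linarith) hℓT0]; linarith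
  have h2 : c / (lam + Real.log (T + 4)) ≤ c / (lam + Real.log (|s.im| + 4)) :=
    div_le_div_of_nonneg_left hc.le hℓ0 hℓT
  linarith

/-- On `U_{λ,c}` with `c ≤ 1/2` we have `Re s > 1/2`; in particular `s ≠ 0`. [folklore] -/
theorem half_lt_re_of_mem_region (hlam : 0 ≤ lam) (hc : 0 < c) (hc2 : c ≤ 1 / 2) {s : ℂ}
    (hs : s ∈ U[lam, c]) : 1 / 2 < s.re := by
  have hℓ1 := one_le_ell hlam s.im
  have h : c / (lam + Real.log (|s.im| + 4)) ≤ c := div_le_self hc.le hℓ1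
  have hs' : 1 - c / (lam + Real.log (|s.im| + 4)) < s.re := hs
  linarith

/-- `s ≠ 0` on `U_{λ,c}` (`c ≤ 1/2`). [folklore] -/
theorem ne_zero_of_mem_region (hlam : 0 ≤ lam) (hc : 0 < c) (hc2 : c ≤ 1 / 2) {s : ℂ}
    (hs : s ∈ U[lam, c]) : s ≠ 0 := by
  intro h
  have := half_lt_re_of_mem_region hlam hc hc2 hs
  rw [h] at this
  simp at this
  linarith

/-! ### Cauchy's theorem on the rectangle `[σ_L, κ] × [−T, T]` -/

/-- **Moving the segment `[κ − iT, κ + iT]` to `Re s = σ_L`**, `σ_L ≥ 1 − c/(2(λ + log(T+4)))`: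
if `Θ` is holomorphic on `U_{λ,c}` and integrable on `Re s = κ`, its line integral equals the two
tails, plus the integral over the left side, plus `i` times (bottom minus top) (Cauchy–Goursat,
Mathlib's `integral_boundary_rect_eq_zero_of_differentiableOn`).
[cite: MontgomeryVaughan2007, §11.3 (proof of Theorem 11.16)] -/
theorem integral_line_eq {Θ : ℂ → ℂ} (hlam : 0 ≤ lam) (hc : 0 < c)
    (hΘ : DifferentiableOn ℂ Θ U[lam, c])
    {κ σL T : ℝ} (hT : 0 < T) (hσLκ : σL ≤ κ)
    (hσL : 1 - c / (2 * (lam + Real.log (T + 4))) ≤ σL)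
    (hint : Integrable fun t : ℝ ↦ Θ (κ + t * I)) :
    ∫ t : ℝ, Θ (κ + t * I) =
      (∫ t in Iic (-T), Θ (κ + t * I)) + (∫ t in Ioi T, Θ (κ + t * I)) +
      (∫ t in (-T)..T, Θ ((σL : ℂ) + t * I)) +
      I * (∫ u in σL..κ, Θ (u + (-T) * I)) - I * (∫ u in σL..κ, Θ (u + T * I)) := by
  have hsplit1 := integral_Iic_add_Ioi (b := -T) hint.integrableOn hint.integrableOn
  have hsplit2 := integral_interval_add_Ioi (a := -T) (b := T) hint.integrableOn hint.integrableOn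
  have hdiff : DifferentiableOn ℂ Θ (uIcc σL κ ×ℂ uIcc (-T) T) := by
    intro s hs
    rw [uIcc_of_le hσLκ, uIcc_of_le (by linarith : -T ≤ T)] at hs
    obtain ⟨⟨hre1, _⟩, him1, him2⟩ := hs
    have hsz : s ∈ U[lam, c] := mem_region_of_rect hlam hc (hσL.trans hre1)
      (abs_le.2 ⟨him1, him2⟩)
    exact (hΘ.differentiableAt ((isOpen_region hlam c).mem_nhds hsz)).differentiableWithinAt
  have H := Complex.integral_boundary_rect_eq_zero_of_differentiableOn Θ ⟨σL, -T⟩ ⟨κ, T⟩ hdiff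
  dsimp only at H
  simp only [smul_eq_mul, ofReal_neg, neg_mul] at H ⊢
  have key : (∫ y : ℝ in (-T)..T, Θ (κ + y * I)) =
      (∫ y : ℝ in (-T)..T, Θ ((σL : ℂ) + y * I)) +
        I * (∫ u : ℝ in σL..κ, Θ (u + -(T * I))) -
        I * (∫ u : ℝ in σL..κ, Θ (u + T * I)) := by
    have hI : I * I = -1 := I_mul_I
    linear_combination (-I) * H +
      ((∫ y : ℝ in (-T)..T, Θ (κ + y * I)) -
        (∫ y : ℝ in (-T)..T, Θ ((σL : ℂ) + y * I))) * hI
  rw [← hsplit1, ← hsplit2, key]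
  ring

/-! ### Bounds for the five pieces -/

section Pieces

variable {Θ F : ℂ → ℂ} {M x : ℝ} {p : ℕ}

/-- **Pointwise bound on the line `Re s = κ ≥ 1` for `t ≠ 0`**: if `‖F(κ+it)‖ ≤ A` then
`‖x^{s} F(s)/s²‖ ≤ x^κ A/t²` (`x ≥ 1`). [folklore] -/
theorem norm_le_tail (hx : 1 ≤ x) (hΘ : ∀ s, Θ s = (x : ℂ) ^ s * (F s / s ^ 2))
    {κ A : ℝ} (hA : ∀ t : ℝ, ‖F (κ + t * I)‖ ≤ A) {t : ℝ} (ht : t ≠ 0) :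
    ‖Θ (κ + t * I)‖ ≤ x ^ κ * A / t ^ 2 := by
  have hx0 : 0 < x := by linarith
  set s : ℂ := κ + t * I with hsdef
  have hre : s.re = κ := by simp [hsdef]
  have hA0 : 0 ≤ A := (norm_nonneg _).trans (hA 0)
  have ht2 : 0 < t ^ 2 := by positivity
  have hnorm2 : t ^ 2 ≤ ‖s‖ ^ 2 := by
    have h : ‖s‖ ^ 2 = κ ^ 2 + t ^ 2 := by
      rw [hsdef, Complex.sq_norm, Complex.normSq_apply]; simp; ring
    rw [h]; nlinarith
  rw [hΘ s, norm_mul, norm_cpow_eq_rpow_re_of_pos hx0, hre, norm_div, norm_pow]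
  calc x ^ κ * (‖F s‖ / ‖s‖ ^ 2) ≤ x ^ κ * (A / t ^ 2) := by
        gcongr
        · exact hA t
    _ = x ^ κ * A / t ^ 2 := by ring

/-- **The upper tail**: `‖∫_T^∞ x^{s} F(s)/s² dt‖ ≤ x^κ A/T` (`Re s = κ`, `T > 0`). [folklore] -/
theorem norm_integral_Ioi_le (hx : 1 ≤ x) (hΘ : ∀ s, Θ s = (x : ℂ) ^ s * (F s / s ^ 2))
    {κ A : ℝ} (hA : ∀ t : ℝ, ‖F (κ + t * I)‖ ≤ A) {T : ℝ} (hT : 0 < T) :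
    ‖∫ t in Ioi T, Θ (κ + t * I)‖ ≤ x ^ κ * A / T := by
  have hA0 : 0 ≤ A := (norm_nonneg _).trans (hA 0)
  have hx0 : 0 < x := by linarith
  set g : ℝ → ℝ := fun t ↦ x ^ κ * A * t ^ (-(2 : ℝ)) with hg
  have hgi : IntegrableOn g (Ioi T) :=
    (integrableOn_Ioi_rpow_of_lt (by norm_num : (-(2 : ℝ)) < -1) hT).const_mul _
  have hbound : ∀ᵐ t : ℝ ∂(volume.restrict (Ioi T)), ‖Θ (κ + t * I)‖ ≤ g t := by
    refine (ae_restrict_iff' measurableSet_Ioi).2 (Eventually.of_forall fun t (ht : T < t) ↦ ?_)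
    have ht0 : 0 < t := hT.trans ht
    have := norm_le_tail hx hΘ hA ht0.ne'
    rw [hg]
    dsimp only
    rwa [Real.rpow_neg ht0.le, Real.rpow_two, ← div_eq_mul_inv]
  refine (norm_integral_le_of_norm_le hgi hbound).trans (le_of_eq ?_)
  rw [hg, MeasureTheory.integral_const_mul, integral_Ioi_rpow_of_lt (by norm_num) hT]
  have : (-(2 : ℝ)) + 1 = -1 := by norm_num
  rw [this, Real.rpow_neg_one]
  field_simp

/-- **The lower tail** (reflect `t ↦ −t`). [folklore] -/
theorem norm_integral_Iic_le (hx : 1 ≤ x) (hΘ : ∀ s, Θ s = (x : ℂ) ^ s * (F s / s ^ 2))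
    {κ A : ℝ} (hA : ∀ t : ℝ, ‖F (κ + t * I)‖ ≤ A) {T : ℝ} (hT : 0 < T) :
    ‖∫ t in Iic (-T), Θ (κ + t * I)‖ ≤ x ^ κ * A / T := by
  have hA0 : 0 ≤ A := (norm_nonneg _).trans (hA 0)
  rw [← integral_comp_neg_Ioi]
  set g : ℝ → ℝ := fun t ↦ x ^ κ * A * t ^ (-(2 : ℝ)) with hg
  have hgi : IntegrableOn g (Ioi T) :=
    (integrableOn_Ioi_rpow_of_lt (by norm_num : (-(2 : ℝ)) < -1) hT).const_mul _
  have hbound : ∀ᵐ t : ℝ ∂(volume.restrict (Ioi T)),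
      ‖Θ (κ + ((-t : ℝ) : ℂ) * I)‖ ≤ g t := by
    refine (ae_restrict_iff' measurableSet_Ioi).2 (Eventually.of_forall fun t (ht : T < t) ↦ ?_)
    have ht0 : 0 < t := hT.trans ht
    have := norm_le_tail hx hΘ hA (neg_ne_zero.2 ht0.ne')
    rw [hg]
    dsimp only
    rwa [Real.rpow_neg ht0.le, Real.rpow_two, ← div_eq_mul_inv, ← neg_sq t]
  refine (norm_integral_le_of_norm_le hgi hbound).trans (le_of_eq ?_)
  rw [hg, MeasureTheory.integral_const_mul, integral_Ioi_rpow_of_lt (by norm_num) hT]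
  have : (-(2 : ℝ)) + 1 = -1 := by norm_num
  rw [this, Real.rpow_neg_one]
  field_simp

/-- **The horizontal sides** `[σ_L, κ] × {±T}` (`σ_L ≥ 1 − c/(2ℓ)`, `ℓ = λ + log(T+4)`, `κ ≤ 2`):
`‖∫_{σ_L}^{κ} x^{u ± iT} F(u ± iT)/(u ± iT)² du‖ ≤ M ℓ^p x^κ/T² · (κ − σ_L)`.
[cite: MontgomeryVaughan2007, §6.2 (proof of Theorem 6.9)] -/
theorem norm_integral_horizontal_le (hlam : 0 ≤ lam) (hc : 0 < c) (hx : 1 ≤ x)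
    (hΘ : ∀ s, Θ s = (x : ℂ) ^ s * (F s / s ^ 2))
    (hFb : ∀ s ∈ U[lam, c], s.re ≤ 2 → ‖F s‖ ≤ M * (lam + Real.log (|s.im| + 4)) ^ p)
    {κ σL T : ℝ} (hκ2 : κ ≤ 2) (hT : 0 < T) (hσLκ : σL ≤ κ)
    (hσL : 1 - c / (2 * (lam + Real.log (T + 4))) ≤ σL) {T' : ℝ} (hT' : |T'| = T) :
    ‖∫ u in σL..κ, Θ (u + T' * I)‖ ≤
      M * (lam + Real.log (T + 4)) ^ p * x ^ κ / T ^ 2 * (κ - σL) := by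
  have hx0 : 0 < x := by linarith
  have hℓT0 : 0 ≤ lam + Real.log (T + 4) := by
    have := one_le_ell hlam T; rw [abs_of_pos hT] at this; linarith
  have hb : ∀ u ∈ Ι σL κ, ‖Θ (u + T' * I)‖ ≤ M * (lam + Real.log (T + 4)) ^ p * x ^ κ / T ^ 2 := by
    intro u hu
    rw [uIoc_of_le hσLκ] at hu
    set s : ℂ := u + T' * I with hsdef
    have him : s.im = T' := by simp [hsdef]
    have hre : s.re = u := by simp [hsdef]
    have hmem : s ∈ U[lam, c] :=
      mem_region_of_rect hlam hc (by rw [hre]; linarith [hu.1]) (by rw [him, hT'])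
    have hF := hFb s hmem (by rw [hre]; linarith [hu.2])
    rw [him, hT'] at hF
    have hnorm2 : T ^ 2 ≤ ‖s‖ ^ 2 := by
      have h : ‖s‖ ^ 2 = u ^ 2 + T' ^ 2 := by
        rw [hsdef, Complex.sq_norm, Complex.normSq_apply]; simp; ring
      rw [h, ← hT', sq_abs]; nlinarith
    have hT2 : 0 < T ^ 2 := by positivity
    have hxu : x ^ u ≤ x ^ κ := Real.rpow_le_rpow_of_exponent_le hx hu.2
    rw [hΘ s, norm_mul, norm_cpow_eq_rpow_re_of_pos hx0, hre, norm_div, norm_pow]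
    calc x ^ u * (‖F s‖ / ‖s‖ ^ 2)
        ≤ x ^ κ * (M * (lam + Real.log (T + 4)) ^ p / T ^ 2) := by
          have h2 : ‖F s‖ / ‖s‖ ^ 2 ≤ M * (lam + Real.log (T + 4)) ^ p / T ^ 2 :=
            (div_le_div_of_nonneg_left (norm_nonneg _) hT2 hnorm2).trans
              (div_le_div_of_nonneg_right hF hT2.le)
          exact mul_le_mul hxu h2 (by positivity) (by positivity)
      _ = M * (lam + Real.log (T + 4)) ^ p * x ^ κ / T ^ 2 := by ring
  have := intervalIntegral.norm_integral_le_of_norm_le_const hb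
  rwa [abs_of_nonneg (by linarith : 0 ≤ κ - σL)] at this

/-- **The left side** `Re s = σ_L ∈ [1/2, 1]`, `σ_L ≥ 1 − c/(2ℓ)`:
`‖∫_{−T}^{T} x^{σ_L+it} F/s² dt‖ ≤ M ℓ^p x^{σ_L} · 2π` (`∫ dt/(σ_L² + t²) = π/σ_L ≤ 2π`).
[cite: MontgomeryVaughan2007, §6.2 (proof of Theorem 6.9)] -/
theorem norm_integral_left_le (hlam : 0 ≤ lam) (hc : 0 < c) (hM : 0 ≤ M) (hx : 1 ≤ x)
    (hΘ : ∀ s, Θ s = (x : ℂ) ^ s * (F s / s ^ 2))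
    (hFb : ∀ s ∈ U[lam, c], s.re ≤ 2 → ‖F s‖ ≤ M * (lam + Real.log (|s.im| + 4)) ^ p)
    {σL T : ℝ} (hT : 0 < T) (hσL0 : 1 / 2 ≤ σL) (hσL1 : σL ≤ 2)
    (hσL : 1 - c / (2 * (lam + Real.log (T + 4))) ≤ σL) :
    ‖∫ t in (-T)..T, Θ ((σL : ℂ) + t * I)‖ ≤
      M * (lam + Real.log (T + 4)) ^ p * x ^ σL * (2 * π) := by
  have hx0 : 0 < x := by linarith
  have hσLpos : 0 < σL := by linarith
  have hℓT0 : 0 ≤ lam + Real.log (T + 4) := by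
    have := one_le_ell hlam T; rw [abs_of_pos hT] at this; linarith
  set A : ℝ := M * (lam + Real.log (T + 4)) ^ p * x ^ σL with hA
  have hA0 : 0 ≤ A := by positivity
  set g : ℝ → ℝ := fun t ↦ A * (1 / (σL ^ 2 + t ^ 2)) with hg
  have hgi : Integrable g := (integrable_inv_sq_add_sq hσLpos).const_mul A
  have hb : ∀ᵐ t : ℝ, t ∈ Ioc (-T) T → ‖Θ ((σL : ℂ) + t * I)‖ ≤ g t := by
    refine Eventually.of_forall fun t ht ↦ ?_
    set s : ℂ := (σL : ℂ) + t * I with hsdef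
    have him : s.im = t := by simp [hsdef]
    have hre : s.re = σL := by simp [hsdef]
    have htT : |t| ≤ T := abs_le.2 ⟨ht.1.le, ht.2⟩
    have hmem : s ∈ U[lam, c] := mem_region_of_rect hlam hc (by rw [hre]; exact hσL)
      (by rw [him]; exact htT)
    have hF := hFb s hmem (by rw [hre]; exact hσL1)
    rw [him] at hF
    have hnorm2 : ‖s‖ ^ 2 = σL ^ 2 + t ^ 2 := by
      rw [hsdef, Complex.sq_norm, Complex.normSq_apply]; simp; ring
    have hpos : 0 < σL ^ 2 + t ^ 2 := by positivity
    have hℓ : (lam + Real.log (|t| + 4)) ^ p ≤ (lam + Real.log (T + 4)) ^ p :=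
      pow_le_pow_left₀ (ell_pos hlam t).le (ell_le_of_abs_le lam htT) p
    have hF' : ‖F s‖ ≤ M * (lam + Real.log (T + 4)) ^ p :=
      hF.trans (mul_le_mul_of_nonneg_left hℓ hM)
    rw [hΘ s, norm_mul, norm_cpow_eq_rpow_re_of_pos hx0, hre, norm_div, norm_pow, hnorm2, hg]
    calc x ^ σL * (‖F s‖ / (σL ^ 2 + t ^ 2))
        ≤ x ^ σL * (M * (lam + Real.log (T + 4)) ^ p / (σL ^ 2 + t ^ 2)) := by gcongr
      _ = A * (1 / (σL ^ 2 + t ^ 2)) := by rw [hA]; ring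
  have h1 := intervalIntegral.norm_integral_le_of_norm_le (by linarith : -T ≤ T) hb
    (hgi.intervalIntegrable)
  refine h1.trans ?_
  rw [intervalIntegral.integral_of_le (by linarith : -T ≤ T)]
  calc ∫ t in Ioc (-T) T, g t ≤ ∫ t, g t :=
        setIntegral_le_integral hgi (Eventually.of_forall fun t ↦ by simp only [hg]; positivity)
    _ = A * (π / σL) := by
        rw [hg, MeasureTheory.integral_const_mul, PerronShift.integral_inv_sq_add_sq hσLpos]
    _ ≤ A * (2 * π) := by
        refine mul_le_mul_of_nonneg_left ?_ hA0
        rw [div_le_iff₀ hσLpos]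
        nlinarith [Real.pi_pos]

/-- **The shifted-contour bound**: for `x ≥ 1`, `1 ≤ κ ≤ 2`, `T > 0`, `0 < c ≤ 1/2`, `λ ≥ 0`,
with `ℓ = λ + log(T+4)` and `σ_L = 1 − c/(2ℓ)`: if `F` is holomorphic on `U_{λ,c}` with
`|F| ≤ Mℓ_λ(t)^p` there (`σ ≤ 2`) and `|F(κ+it)| ≤ A`, then
`‖∫ x^{κ+it} F(κ+it)/(κ+it)² dt‖ ≤ 2x^κA/T + 2πMℓ^p x^{σ_L} + 2(κ−σ_L)Mℓ^p x^κ/T²`.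
[cite: MontgomeryVaughan2007, §6.2 (proof of Theorem 6.9) and §11.3] -/
theorem norm_integral_le (hlam : 0 ≤ lam) (hc : 0 < c) (hc2 : c ≤ 1 / 2) (hM : 0 ≤ M)
    (hx : 1 ≤ x) (hΘ : ∀ s, Θ s = (x : ℂ) ^ s * (F s / s ^ 2))
    (hFd : DifferentiableOn ℂ F U[lam, c])
    (hFb : ∀ s ∈ U[lam, c], s.re ≤ 2 → ‖F s‖ ≤ M * (lam + Real.log (|s.im| + 4)) ^ p)
    {κ A : ℝ} (hκ1 : 1 ≤ κ) (hκ2 : κ ≤ 2) (hA : ∀ t : ℝ, ‖F (κ + t * I)‖ ≤ A)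
    {T : ℝ} (hT : 0 < T) (hint : Integrable fun t : ℝ ↦ Θ (κ + t * I)) :
    ‖∫ t : ℝ, Θ (κ + t * I)‖ ≤
      2 * (x ^ κ * A / T) +
      M * (lam + Real.log (T + 4)) ^ p * x ^ (1 - c / (2 * (lam + Real.log (T + 4)))) * (2 * π) +
      2 * (M * (lam + Real.log (T + 4)) ^ p * x ^ κ / T ^ 2 *
        (κ - (1 - c / (2 * (lam + Real.log (T + 4)))))) := by
  have hx0 : 0 < x := by linarith
  set ℓ : ℝ := lam + Real.log (T + 4) with hℓ
  have hℓ1 : 1 ≤ ℓ := by have := one_le_ell hlam T; rwa [abs_of_pos hT] at this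
  have hℓ0 : 0 < ℓ := by linarith
  set σL : ℝ := 1 - c / (2 * ℓ) with hσLdef
  have hcℓ : c / (2 * ℓ) ≤ 1 / 4 := by
    have h1 : c / (2 * ℓ) ≤ c / 2 := div_le_div_of_nonneg_left hc.le two_pos (by linarith)
    linarith
  have hcℓ0 : 0 < c / (2 * ℓ) := by positivity
  have hσL0 : 1 / 2 ≤ σL := by rw [hσLdef]; linarith
  have hσL1 : σL ≤ 1 := by rw [hσLdef]; linarith
  have hσLκ : σL ≤ κ := by linarith
  -- `Θ` is holomorphic on the region
  have hΘd : DifferentiableOn ℂ Θ U[lam, c] := by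
    have : Θ = fun s ↦ (x : ℂ) ^ s * (F s / s ^ 2) := funext hΘ
    rw [this]
    refine DifferentiableOn.mul (fun s _ ↦ ?_) (hFd.div (fun s _ ↦ ?_) fun s hs ↦ ?_)
    · exact (differentiableAt_id.const_cpow
        (Or.inl (ofReal_ne_zero.2 hx0.ne'))).differentiableWithinAt
    · exact (differentiableAt_id.pow 2).differentiableWithinAt
    · exact pow_ne_zero _ (ne_zero_of_mem_region hlam hc hc2 hs)
  have hsplit := integral_line_eq hlam hc hΘd hT hσLκ le_rfl hint
  have b1 := norm_integral_Iic_le hx hΘ hA hT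
  have b2 := norm_integral_Ioi_le hx hΘ hA hT
  have b3 := norm_integral_left_le hlam hc hM hx hΘ hFb hT hσL0 (by linarith) le_rfl
  have b4 := norm_integral_horizontal_le hlam hc hx hΘ hFb hκ2 hT hσLκ le_rfl (T' := -T)
    (by rw [abs_neg, abs_of_pos hT])
  have b5 := norm_integral_horizontal_le hlam hc hx hΘ hFb hκ2 hT hσLκ le_rfl (T' := T)
    (abs_of_pos hT)
  simp only [ofReal_neg, neg_mul] at b4 hsplit
  have hI : ∀ z : ℂ, ‖I * z‖ = ‖z‖ := fun z ↦ by rw [norm_mul, norm_I, one_mul]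
  rw [hsplit]
  refine (ClassicalPsiData.norm_add_add_add_sub_le _ _ _ _ _).trans ?_
  rw [hI, hI]
  have := add_le_add (add_le_add (add_le_add (add_le_add b1 b2) b3) b4) b5
  refine this.trans (le_of_eq ?_)
  ring

end Pieces

/-! ### The logarithmic Riesz mean -/

section Main

variable {a : ℕ → ℂ} {F : ℂ → ℂ} {M B x : ℝ} {p : ℕ}

/-- `x^{1 + 1/log x} = e·x` for `x > 1`. [folklore] -/
theorem rpow_one_add_inv_log {x : ℝ} (hx : 1 < x) : x ^ (1 + 1 / Real.log x) = Real.exp 1 * x := by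
  have hx0 : 0 < x := by linarith
  have hL : Real.log x ≠ 0 := (Real.log_pos hx).ne'
  rw [Real.rpow_add hx0, Real.rpow_one, Real.rpow_def_of_pos hx0, mul_one_div_cancel hL, mul_comm]

/-- **The logarithmic Riesz mean by the shifted contour** (general `T`): under the hypotheses of
the file docstring, for `log x ≥ 2` and `T > 0`, with `ℓ = λ + log(T+4)`,
`‖∑_{n≤x} a(n) log(x/n)‖ ≤ B x log x/T + M ℓ^p x^{1−c/(2ℓ)} + M ℓ^p x/T²`
(we use `e/π ≤ 1`). [cite: MontgomeryVaughan2007, §6.2 (proof of Theorem 6.9) and §11.3] -/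
theorem norm_logRieszMean_le (hlam : 0 ≤ lam) (hc : 0 < c) (hc2 : c ≤ 1 / 2) (hM : 0 ≤ M)
    (hsum : ∀ σ : ℝ, 1 < σ → LSeriesSummable a σ)
    (hB : ∀ σ : ℝ, 1 < σ → σ ≤ 2 → ∑' n, ‖LSeries.term a σ n‖ ≤ B / (σ - 1))
    (hFa : ∀ s : ℂ, 1 < s.re → F s = LSeries a s)
    (hFd : DifferentiableOn ℂ F U[lam, c])
    (hFb : ∀ s ∈ U[lam, c], s.re ≤ 2 → ‖F s‖ ≤ M * (lam + Real.log (|s.im| + 4)) ^ p)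
    (hx : Real.exp 2 ≤ x) {T : ℝ} (hT : 0 < T) :
    ‖∑ n ∈ Finset.Ioc 0 ⌊x⌋₊, a n * (Real.log (x / n) : ℂ)‖ ≤
      B * x * Real.log x / T +
      M * (lam + Real.log (T + 4)) ^ p * (x * x ^ (-(c / (2 * (lam + Real.log (T + 4)))))) +
      M * (lam + Real.log (T + 4)) ^ p * x / T ^ 2 := by
  have hx0 : 0 < x := (Real.exp_pos 2).trans_le hx
  have hx1 : 1 < x := by
    have : (1 : ℝ) < Real.exp 2 := by have := Real.add_one_le_exp (2 : ℝ); linarith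
    linarith
  set L : ℝ := Real.log x with hL
  have hL2 : 2 ≤ L := by rw [hL, Real.le_log_iff_exp_le hx0]; exact hx
  have hL0 : 0 < L := by linarith
  set κ : ℝ := 1 + 1 / L with hκ
  have hLinv0 : 0 < 1 / L := by positivity
  have hLinv : 1 / L ≤ 1 / 2 := by
    rw [div_le_div_iff_of_pos_left one_pos hL0 two_pos]; exact hL2
  have hκ1 : 1 < κ := by rw [hκ]; linarith
  have hκ2 : κ ≤ 2 := by rw [hκ]; linarith
  have hxκ : x ^ κ = Real.exp 1 * x := rpow_one_add_inv_log hx1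
  -- Perron's formula
  have hP := LogRieszMean.sum_mul_log_eq_integral_LSeries a hx0 (by linarith : 0 < κ) (hsum κ hκ1)
  set Θ : ℂ → ℂ := fun s ↦ (x : ℂ) ^ s * (F s / s ^ 2) with hΘdef
  have hΘ : ∀ s, Θ s = (x : ℂ) ^ s * (F s / s ^ 2) := fun s ↦ rfl
  have hline : ∀ t : ℝ, (x : ℂ) ^ ((κ : ℂ) + t * I) * LSeries a (κ + t * I) *
      (1 / ((κ : ℂ) + t * I) ^ 2) = Θ (κ + t * I) := by
    intro t
    have hre : 1 < ((κ : ℂ) + t * I).re := by simp; exact hκ1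
    rw [hΘ, hFa _ hre]; ring
  have hint : Integrable fun t : ℝ ↦ Θ (κ + t * I) := by
    have := LogRieszMean.integrable_cpow_mul_LSeries_mul_invSq a hx0 (by linarith : 0 < κ) (hsum κ hκ1)
    exact this.congr (Eventually.of_forall hline)
  rw [hP, integral_congr_ae (Eventually.of_forall hline)]
  -- the bound on the line `σ = κ`
  set A : ℝ := ∑' n, ‖LSeries.term a κ n‖ with hAdef
  have hA : ∀ t : ℝ, ‖F (κ + t * I)‖ ≤ A := by
    intro t
    have hre : 1 < ((κ : ℂ) + t * I).re := by simp; exact hκ1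
    rw [hFa _ hre]
    exact NumberField.norm_LSeries_le_tsum (hsum κ hκ1) (by simp)
  have hAB : A ≤ B * L := by
    have h1 := hB κ hκ1 hκ2
    have hκm : B / (κ - 1) = B * L := by
      rw [hκ, show 1 + 1 / L - 1 = 1 / L by ring, div_div_eq_mul_div, div_one]
    rw [hκm] at h1
    rw [hAdef]
    exact h1
  have hmain := norm_integral_le hlam hc hc2 hM hx1.le hΘ hFd hFb hκ1.le hκ2 hA hT hint
  have hnorm : ‖(1 / (2 * π) : ℂ)‖ = 1 / (2 * π) := by
    have h1 : (1 / (2 * π) : ℂ) = ((1 / (2 * π) : ℝ) : ℂ) := by push_cast; ring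
    rw [h1, Complex.norm_real, Real.norm_eq_abs, abs_of_pos (by positivity)]
  rw [norm_mul, hnorm]
  set ℓ : ℝ := lam + Real.log (T + 4) with hℓ
  have hℓ1 : 1 ≤ ℓ := by have := one_le_ell hlam T; rwa [abs_of_pos hT] at this
  have hℓ0 : 0 < ℓ := by linarith
  have hcℓ : c / (2 * ℓ) ≤ 1 / 4 := by
    have h1 : c / (2 * ℓ) ≤ c / 2 := div_le_div_of_nonneg_left hc.le two_pos (by linarith)
    linarith
  have hcℓ0 : 0 < c / (2 * ℓ) := by positivity
  have hwidth : κ - (1 - c / (2 * ℓ)) ≤ 1 := by rw [hκ]; linarith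
  have hwidth0 : 0 ≤ κ - (1 - c / (2 * ℓ)) := by linarith
  have hxσ : x ^ (1 - c / (2 * ℓ)) = x * x ^ (-(c / (2 * ℓ))) := by
    rw [sub_eq_add_neg, Real.rpow_add hx0, Real.rpow_one]
  have hπ : 0 < 2 * π := by positivity
  have heπ : Real.exp 1 / π ≤ 1 := by
    rw [div_le_one Real.pi_pos]
    linarith [Real.exp_one_lt_d9, Real.pi_gt_three]
  have hA0 : 0 ≤ A := by positivity
  have hB0 : 0 ≤ B * L := hA0.trans hAB
  have hMℓ : 0 ≤ M * ℓ ^ p := by positivity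
  rw [hxκ, hxσ] at hmain
  calc 1 / (2 * π) * ‖∫ t : ℝ, Θ (κ + t * I)‖
      ≤ 1 / (2 * π) * (2 * (Real.exp 1 * x * A / T) +
          M * ℓ ^ p * (x * x ^ (-(c / (2 * ℓ)))) * (2 * π) +
          2 * (M * ℓ ^ p * (Real.exp 1 * x) / T ^ 2 * (κ - (1 - c / (2 * ℓ))))) :=
        mul_le_mul_of_nonneg_left hmain (by positivity)
    _ = Real.exp 1 / π * (x * A / T) + M * ℓ ^ p * (x * x ^ (-(c / (2 * ℓ)))) +
          Real.exp 1 / π * (M * ℓ ^ p * x / T ^ 2) * (κ - (1 - c / (2 * ℓ))) := by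
        field_simp
    _ ≤ 1 * (x * (B * L) / T) + M * ℓ ^ p * (x * x ^ (-(c / (2 * ℓ)))) +
          1 * (M * ℓ ^ p * x / T ^ 2) * 1 := by
        gcongr
    _ = B * x * L / T + M * ℓ ^ p * (x * x ^ (-(c / (2 * ℓ)))) + M * ℓ ^ p * x / T ^ 2 := by ring

/-- `log(e^r + 4) ≤ r + 2` for `r ≥ 0`. [folklore] -/
theorem log_exp_add_four_le {r : ℝ} (hr : 0 ≤ r) : Real.log (Real.exp r + 4) ≤ r + 2 := by
  have he : (7 : ℝ) ≤ Real.exp 2 := by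
    have h1 := Real.exp_one_gt_d9
    have h' : Real.exp 2 = Real.exp 1 * Real.exp 1 := by rw [← Real.exp_add]; norm_num
    rw [h']; nlinarith
  have hr1 : 1 ≤ Real.exp r := Real.one_le_exp hr
  have h : Real.exp r + 4 ≤ Real.exp (r + 2) := by rw [Real.exp_add]; nlinarith
  calc Real.log (Real.exp r + 4) ≤ Real.log (Real.exp (r + 2)) :=
        Real.log_le_log (by positivity) h
    _ = r + 2 := Real.log_exp _

/-- **The logarithmic Riesz mean, `T = exp(√log x)`**: for `log x ≥ 4` and every `λ ≥ 0`,
`‖∑_{n≤x} a(n) log(x/n)‖ ≤ B x log x e^{−√log x}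
  + M (λ + √log x + 2)^p x (exp(−c log x/(2(λ + √log x + 2))) + e^{−2√log x})`.
[cite: MontgomeryVaughan2007, §6.2 (proof of Theorem 6.9) and §11.3] -/
theorem norm_logRieszMean_le_sqrt (hlam : 0 ≤ lam) (hc : 0 < c) (hc2 : c ≤ 1 / 2) (hM : 0 ≤ M)
    (hsum : ∀ σ : ℝ, 1 < σ → LSeriesSummable a σ)
    (hB : ∀ σ : ℝ, 1 < σ → σ ≤ 2 → ∑' n, ‖LSeries.term a σ n‖ ≤ B / (σ - 1))
    (hFa : ∀ s : ℂ, 1 < s.re → F s = LSeries a s)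
    (hFd : DifferentiableOn ℂ F U[lam, c])
    (hFb : ∀ s ∈ U[lam, c], s.re ≤ 2 → ‖F s‖ ≤ M * (lam + Real.log (|s.im| + 4)) ^ p)
    (hx : Real.exp 4 ≤ x) :
    ‖∑ n ∈ Finset.Ioc 0 ⌊x⌋₊, a n * (Real.log (x / n) : ℂ)‖ ≤
      B * x * Real.log x * Real.exp (-Real.sqrt (Real.log x)) +
      M * (lam + Real.sqrt (Real.log x) + 2) ^ p * x *
        (Real.exp (-(c * Real.log x / (2 * (lam + Real.sqrt (Real.log x) + 2)))) +
          Real.exp (-(2 * Real.sqrt (Real.log x)))) := by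
  have hx0 : 0 < x := (Real.exp_pos 4).trans_le hx
  have hx2 : Real.exp 2 ≤ x := (Real.exp_le_exp.2 (by norm_num)).trans hx
  set L : ℝ := Real.log x with hL
  have hL4 : 4 ≤ L := by rw [hL, Real.le_log_iff_exp_le hx0]; exact hx
  have hL0 : 0 < L := by linarith
  set r : ℝ := Real.sqrt L with hr
  have hr2 : 2 ≤ r := by
    have h4 : Real.sqrt 4 = 2 := by
      rw [show (4 : ℝ) = 2 ^ 2 by norm_num, Real.sqrt_sq (by norm_num : (0 : ℝ) ≤ 2)]
    rw [hr, ← h4]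
    exact Real.sqrt_le_sqrt hL4
  have hr0 : 0 < r := by linarith
  have hrr : r * r = L := Real.mul_self_sqrt hL0.le
  set T : ℝ := Real.exp r with hT
  have hT0 : 0 < T := Real.exp_pos r
  have h := norm_logRieszMean_le hlam hc hc2 hM hsum hB hFa hFd hFb hx2 hT0
  set ℓ : ℝ := lam + Real.log (T + 4) with hℓ
  set ℓ' : ℝ := lam + r + 2 with hℓ'
  have hℓ1 : 1 ≤ ℓ := by have := one_le_ell hlam T; rwa [abs_of_pos hT0] at this
  have hℓ0 : 0 < ℓ := by linarith
  have hℓℓ' : ℓ ≤ ℓ' := by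
    have := log_exp_add_four_le hr0.le
    rw [hℓ, hℓ', hT]; linarith
  have hℓ'0 : 0 < ℓ' := hℓ0.trans_le hℓℓ'
  have hpow : ℓ ^ p ≤ ℓ' ^ p := pow_le_pow_left₀ hℓ0.le hℓℓ' p
  -- the three terms
  have h1 : B * x * L / T = B * x * L * Real.exp (-r) := by
    rw [hT, Real.exp_neg, div_eq_mul_inv]
  have h2 : x ^ (-(c / (2 * ℓ))) ≤ Real.exp (-(c * L / (2 * ℓ'))) := by
    rw [Real.rpow_def_of_pos hx0, ← hL, Real.exp_le_exp]
    have e1 : L * -(c / (2 * ℓ)) = -(c * L / (2 * ℓ)) := by ring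
    rw [e1, neg_le_neg_iff]
    have hcL : 0 ≤ c * L := by positivity
    exact div_le_div_of_nonneg_left hcL (by positivity) (by linarith)
  have h3 : x / T ^ 2 = x * Real.exp (-(2 * r)) := by
    rw [hT, ← Real.exp_nat_mul, Real.exp_neg, div_eq_mul_inv]; norm_num
  have hB0 : 0 ≤ B * x * L / T := by
    have : 0 ≤ B := by
      have h' := hB 2 (by norm_num) le_rfl
      have h0 : 0 ≤ ∑' n, ‖LSeries.term a 2 n‖ := by positivity
      have : 0 ≤ B / (2 - 1) := h0.trans h'
      rwa [show (2 : ℝ) - 1 = 1 by norm_num, div_one] at this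
    positivity
  calc ‖∑ n ∈ Finset.Ioc 0 ⌊x⌋₊, a n * (Real.log (x / n) : ℂ)‖
      ≤ B * x * L / T + M * ℓ ^ p * (x * x ^ (-(c / (2 * ℓ)))) + M * ℓ ^ p * x / T ^ 2 := h
    _ ≤ B * x * L * Real.exp (-r) + M * ℓ' ^ p * (x * Real.exp (-(c * L / (2 * ℓ')))) +
          M * ℓ' ^ p * (x * Real.exp (-(2 * r))) := by
        rw [h1, mul_div_assoc, h3]
        gcongr
    _ = _ := by ring

/-- **The logarithmic Riesz mean for `λ ≤ √log x`** (the uniformity range of Mitsui's theorem /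
Heath-Brown's Lemma 9.4): for `log x ≥ 4` and `0 ≤ λ ≤ √log x`,
`‖∑_{n≤x} a(n) log(x/n)‖ ≤ (B + 2·3^p·M) (log x)^{p+1} x exp(−(c/6)√log x)`.
[cite: HeathBrownActa2001, Lemma 9.4] -/
theorem norm_logRieszMean_le_of_le_sqrt (hlam : 0 ≤ lam) (hc : 0 < c) (hc2 : c ≤ 1 / 2)
    (hM : 0 ≤ M)
    (hsum : ∀ σ : ℝ, 1 < σ → LSeriesSummable a σ)
    (hB : ∀ σ : ℝ, 1 < σ → σ ≤ 2 → ∑' n, ‖LSeries.term a σ n‖ ≤ B / (σ - 1))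
    (hFa : ∀ s : ℂ, 1 < s.re → F s = LSeries a s)
    (hFd : DifferentiableOn ℂ F U[lam, c])
    (hFb : ∀ s ∈ U[lam, c], s.re ≤ 2 → ‖F s‖ ≤ M * (lam + Real.log (|s.im| + 4)) ^ p)
    (hx : Real.exp 4 ≤ x) (hlamx : lam ≤ Real.sqrt (Real.log x)) :
    ‖∑ n ∈ Finset.Ioc 0 ⌊x⌋₊, a n * (Real.log (x / n) : ℂ)‖ ≤
      (B + 2 * 3 ^ p * M) * Real.log x ^ (p + 1) * x *
        Real.exp (-(c / 6 * Real.sqrt (Real.log x))) := by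
  have hx0 : 0 < x := (Real.exp_pos 4).trans_le hx
  have h := norm_logRieszMean_le_sqrt hlam hc hc2 hM hsum hB hFa hFd hFb hx
  set L : ℝ := Real.log x with hL
  have hL4 : 4 ≤ L := by rw [hL, Real.le_log_iff_exp_le hx0]; exact hx
  have hL1 : 1 ≤ L := by linarith
  have hL0 : 0 < L := by linarith
  set r : ℝ := Real.sqrt L with hr
  have hr2 : 2 ≤ r := by
    have h4 : Real.sqrt 4 = 2 := by
      rw [show (4 : ℝ) = 2 ^ 2 by norm_num, Real.sqrt_sq (by norm_num : (0 : ℝ) ≤ 2)]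
    rw [hr, ← h4]
    exact Real.sqrt_le_sqrt hL4
  have hr0 : 0 < r := by linarith
  have hrr : r * r = L := Real.mul_self_sqrt hL0.le
  have hrL : r ≤ L := by nlinarith
  have hB0 : 0 ≤ B := by
    have h' := hB 2 (by norm_num) le_rfl
    have h0 : 0 ≤ ∑' n, ‖LSeries.term a 2 n‖ := by positivity
    have : 0 ≤ B / (2 - 1) := h0.trans h'
    rwa [show (2 : ℝ) - 1 = 1 by norm_num, div_one] at this
  set ℓ' : ℝ := lam + r + 2 with hℓ'
  have hℓ'3 : ℓ' ≤ 3 * r := by rw [hℓ']; linarith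
  have hℓ'0 : 0 < ℓ' := by rw [hℓ']; linarith
  set E : ℝ := Real.exp (-(c / 6 * r)) with hE
  -- the three exponentials are `≤ E`
  have e1 : Real.exp (-r) ≤ E := by
    rw [hE, Real.exp_le_exp]; nlinarith
  have e2 : Real.exp (-(c * L / (2 * ℓ'))) ≤ E := by
    rw [hE, Real.exp_le_exp, neg_le_neg_iff]
    rw [div_mul_eq_mul_div, div_le_div_iff₀ (by norm_num : (0 : ℝ) < 6)
      (by positivity : (0 : ℝ) < 2 * ℓ')]
    calc c * r * (2 * ℓ') ≤ c * r * (2 * (3 * r)) := by gcongr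
      _ = c * L * 6 := by rw [← hrr]; ring
  have e3 : Real.exp (-(2 * r)) ≤ E := by
    rw [hE, Real.exp_le_exp]; nlinarith
  have hpow : ℓ' ^ p ≤ 3 ^ p * L ^ p := by
    calc ℓ' ^ p ≤ (3 * r) ^ p := pow_le_pow_left₀ hℓ'0.le hℓ'3 p
      _ = 3 ^ p * r ^ p := mul_pow _ _ _
      _ ≤ 3 ^ p * L ^ p := by gcongr
  have hLp : L ≤ L ^ (p + 1) := by
    calc L = L ^ 1 := (pow_one L).symm
      _ ≤ L ^ (p + 1) := pow_le_pow_right₀ hL1 (by omega)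
  have hLp' : L ^ p ≤ L ^ (p + 1) := pow_le_pow_right₀ hL1 (by omega)
  have hE0 : 0 < E := Real.exp_pos _
  calc ‖∑ n ∈ Finset.Ioc 0 ⌊x⌋₊, a n * (Real.log (x / n) : ℂ)‖
      ≤ B * x * L * Real.exp (-r) +
          M * ℓ' ^ p * x * (Real.exp (-(c * L / (2 * ℓ'))) + Real.exp (-(2 * r))) := h
    _ ≤ B * x * L ^ (p + 1) * E + M * (3 ^ p * L ^ (p + 1)) * x * (E + E) := by
        gcongr
        exact hpow.trans (by gcongr)
    _ = (B + 2 * 3 ^ p * M) * L ^ (p + 1) * x * E := by ring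

end Main

/-! ### From the logarithmic Riesz mean to the sharp cut-off -/

/-- **Differencing**: if `‖a(n)‖ ≤ b(n)` then for `0 < x < y`, writing `R(z) = ∑_{n≤z} a(n) log(z/n)`,
`‖∑_{n ≤ x} a(n)‖ ≤ (‖R(y)‖ + ‖R(x)‖)/log(y/x) + ∑_{x < n ≤ y} b(n)`
(for `n ≤ x`, `log(y/n) − log(x/n) = log(y/x)`; for `x < n ≤ y`, `0 ≤ log(y/n) ≤ log(y/x)`).
[cite: MontgomeryVaughan2007, §6.2 (Theorem 6.9, last step)] -/
theorem norm_sum_le_of_logRieszMean {a : ℕ → ℂ} {b : ℕ → ℝ} (hab : ∀ n, ‖a n‖ ≤ b n)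
    {x y : ℝ} (hx : 0 < x) (hxy : x < y) :
    ‖∑ n ∈ Finset.Ioc 0 ⌊x⌋₊, a n‖ ≤
      (‖∑ n ∈ Finset.Ioc 0 ⌊y⌋₊, a n * (Real.log (y / n) : ℂ)‖ +
          ‖∑ n ∈ Finset.Ioc 0 ⌊x⌋₊, a n * (Real.log (x / n) : ℂ)‖) / Real.log (y / x) +
        ∑ n ∈ Finset.Ioc ⌊x⌋₊ ⌊y⌋₊, b n := by
  have hy : 0 < y := hx.trans hxy
  set h : ℝ := Real.log (y / x) with hh
  have hh0 : 0 < h := Real.log_pos ((one_lt_div hx).2 hxy)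
  have hfl : ⌊x⌋₊ ≤ ⌊y⌋₊ := Nat.floor_le_floor hxy.le
  set S : ℂ := ∑ n ∈ Finset.Ioc 0 ⌊x⌋₊, a n with hS
  set Rx : ℂ := ∑ n ∈ Finset.Ioc 0 ⌊x⌋₊, a n * (Real.log (x / n) : ℂ) with hRx
  set Ry : ℂ := ∑ n ∈ Finset.Ioc 0 ⌊y⌋₊, a n * (Real.log (y / n) : ℂ) with hRy
  set Q : ℂ := ∑ n ∈ Finset.Ioc ⌊x⌋₊ ⌊y⌋₊, a n * (Real.log (y / n) : ℂ) with hQ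
  set W : ℝ := ∑ n ∈ Finset.Ioc ⌊x⌋₊ ⌊y⌋₊, b n with hW
  -- `R(y) = R(x) + h S + Q`
  have hsplit : Ry = Rx + (h : ℂ) * S + Q := by
    have h1 : ∑ n ∈ Finset.Ioc 0 ⌊x⌋₊, a n * (Real.log (y / n) : ℂ) = Rx + (h : ℂ) * S := by
      rw [hRx, hS, Finset.mul_sum, ← Finset.sum_add_distrib]
      refine Finset.sum_congr rfl fun n hn ↦ ?_
      rw [Finset.mem_Ioc] at hn
      have hn0 : (0 : ℝ) < n := Nat.cast_pos.2 hn.1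
      have : Real.log (y / n) = Real.log (x / n) + h := by
        rw [hh, ← Real.log_mul (div_pos hx hn0).ne' (div_pos hy hx).ne']
        congr 1; field_simp
      rw [this]; push_cast; ring
    rw [hRy, ← Finset.sum_Ioc_consecutive _ (Nat.zero_le _) hfl, h1]
  have hS_eq : (h : ℂ) * S = Ry - Rx - Q := by rw [hsplit]; ring
  -- bound `Q`
  have hQb : ‖Q‖ ≤ h * W := by
    rw [hQ, hW, Finset.mul_sum]
    refine (norm_sum_le _ _).trans (Finset.sum_le_sum fun n hn ↦ ?_)
    rw [Finset.mem_Ioc] at hn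
    have hnx : x < n := by
      have := Nat.lt_of_floor_lt hn.1
      exact_mod_cast this
    have hn0 : (0 : ℝ) < n := hx.trans hnx
    have hny : (n : ℝ) ≤ y := (Nat.cast_le.2 hn.2).trans (Nat.floor_le hy.le)
    have hlog0 : 0 ≤ Real.log (y / n) := Real.log_nonneg ((one_le_div hn0).2 hny)
    have hlogh : Real.log (y / n) ≤ h := by
      rw [hh]; exact Real.log_le_log (div_pos hy hn0) (div_le_div_of_nonneg_left hy.le hx hnx.le)
    rw [norm_mul, Complex.norm_real, Real.norm_eq_abs, abs_of_nonneg hlog0, mul_comm]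
    exact mul_le_mul hlogh (hab n) (norm_nonneg _) hh0.le
  have hnS : h * ‖S‖ ≤ ‖Ry‖ + ‖Rx‖ + h * W := by
    have : ‖(h : ℂ) * S‖ = h * ‖S‖ := by
      rw [norm_mul, Complex.norm_real, Real.norm_eq_abs, abs_of_pos hh0]
    rw [← this, hS_eq]
    calc ‖Ry - Rx - Q‖ ≤ ‖Ry - Rx‖ + ‖Q‖ := norm_sub_le _ _
      _ ≤ ‖Ry‖ + ‖Rx‖ + ‖Q‖ := by gcongr; exact norm_sub_le _ _
      _ ≤ _ := by gcongr
  have key : ‖S‖ ≤ (‖Ry‖ + ‖Rx‖) / h + W := by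
    rw [div_add' _ _ _ hh0.ne', le_div_iff₀ hh0]
    linarith
  exact key

end PerronConductor

end Literature.NumberTheory.LFunctions
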